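import Mathlib
import HarnessLib
import Literature.Combinatorics.Additive.Pollard
import Literature.Combinatorics.Additive.Kneser
import Literature.Combinatorics.Additive.GrynkiewiczPollardRep
import Literature.Combinatorics.Additive.GrynkiewiczPollardKneserTools
import Literature.Combinatorics.Additive.GrynkiewiczPollardStepOne
import Literature.Combinatorics.Additive.GrynkiewiczPollardStepTwo
import Literature.Combinatorics.Additive.GrynkiewiczPollardDyson

/-!
# Grynkiewicz's extension of Pollard's theorem — port, part VIII: STEP 4 tools and Case 4.1

Topic: `Literature/Combinatorics/Additive`.  Eighth file of the port of [Gry10] Theorem 1.1 / 1.2.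
STEP 4 of [Gry10] §2 applies the induction hypothesis to the Dyson pair `(U, I) = (A ∪ B, A ∩ B)` (after
translating `B`).  This file provides the tools shared by Cases 4.1 and 4.2 and proves Case 4.1:

* `key_count` — the counting inequality `N_t(A,B) + l|E| ≥ t|U′+I′| + t|E| + #{(u,i) : u + i ∉ U′ + I′}`
  for a structured pair `(U,I)` below `(A,B)` and a set `E` of `t`-popular sums outside `U′ + I′`;
* `two_cosets_holes` — two distinct cosets meeting `U` carry at least `2|H| − ρ_U` points of `U`;
* `le_rep_add_holes` — `r_{X,Y}(x + y) ≥ |H| − ρ` for `x ∈ X`, `y ∈ Y`, `H = stab(X + Y)`;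
* `goal_of_insert_right` / `goal_of_insert_left` — adding an element all of whose sums are already
  `t`-popular (the device of Case 4.2: `X, Y` with `|X| + |Y| = |A| + |B| + 1`);
* `case41` — Case 4.1 (`l ≥ 1`).

## References
* D. J. Grynkiewicz, *On extending Pollard's theorem for t-representable sums*, Israel J. Math. 177 (2010)
  413–439 (arXiv:0803.2601), §2 Case 4.1 [cite: Grynkiewicz2010, Thm 1.1].
-/

namespace Literature.Combinatorics.Additive

namespace Grynkiewicz

open Finset Pollard
open scoped Pointwise

variable {G : Type*} [AddCommGroup G] [DecidableEq G]

section Tools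

variable {t c : ℕ} {A B : Finset G}

/-- **The key count.**  Let `Str t U I U′ I′` with `r_{U,I} ≤ r_{A,B}` pointwise and `U + I ⊆ A + B`, and let
`E ⊆ A + B` be a set of `t`-popular sums of `A + B` disjoint from `U′ + I′`.  Then
`t|U′ + I′| + t|E| + #{(u,i) ∈ U × I : u + i ∉ U′ + I′} ≤ N_t(A,B) + l |E|`. [cite: Grynkiewicz2010, §2 Case 4.1] -/
theorem key_count {U I U' I' E : Finset G} (hS : Str t U I U' I') (hrep : ∀ w, rep U I w ≤ rep A B w)
    (hsub : U + I ⊆ A + B) (hE : E ⊆ A + B) (hEout : Disjoint E (U' + I'))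
    (hEpop : ∀ w ∈ E, t ≤ rep A B w) :
    t * (U' + I').card + t * E.card + ((U ×ˢ I).filter (fun p => p.1 + p.2 ∉ U' + I')).card ≤
      NS t A B + ((U \ U').card + (I \ I').card) * E.card := by
  set l := (U \ U').card + (I \ I').card with hl
  set P := U' + I' with hP
  have hlt : l + 1 ≤ t := hS.2.2.1
  have hPsub : P ⊆ A + B := hS.add_subset.trans hsub
  set S0 := (A + B).filter (fun w => w ∉ P) with hS0
  -- `N_t` split along `P` and `E`
  have hN : NS t A B = ∑ w ∈ P, min t (rep A B w) + (∑ w ∈ E, min t (rep A B w) +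
      ∑ w ∈ S0.filter (fun w => w ∉ E), min t (rep A B w)) := by
    unfold NS
    rw [← sum_filter_add_sum_filter_not (A + B) (fun w => w ∈ P), filter_mem_eq_inter,
      inter_eq_right.2 hPsub, ← hS0, ← sum_filter_add_sum_filter_not S0 (fun w => w ∈ E)]
    congr 2
    apply sum_congr _ (fun _ _ => rfl)
    ext w
    simp only [hS0, mem_filter]
    constructor
    · rintro ⟨-, hw⟩; exact hw
    · intro hw; exact ⟨⟨hE hw, fun hwP => disjoint_left.1 hEout hw hwP⟩, hw⟩
  have h1 : t * P.card ≤ ∑ w ∈ P, min t (rep A B w) := by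
    rw [mul_comm, card_eq_sum_ones, sum_mul]
    refine sum_le_sum fun w hw => ?_
    rw [one_mul]
    exact le_min le_rfl ((hS.2.2.2.1 w hw).trans ((rep_mono hS.1 hS.2.1 w).trans (hrep w)))
  have h2 : t * E.card ≤ ∑ w ∈ E, min t (rep A B w) := by
    rw [mul_comm, card_eq_sum_ones, sum_mul]
    refine sum_le_sum fun w hw => ?_
    rw [one_mul]
    exact le_min le_rfl (hEpop w hw)
  have h3 : ∑ w ∈ S0.filter (fun w => w ∉ E), rep U I w ≤
      ∑ w ∈ S0.filter (fun w => w ∉ E), min t (rep A B w) := by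
    refine sum_le_sum fun w hw => ?_
    have hwP : w ∉ P := (mem_filter.1 (mem_filter.1 hw).1).2
    have := rep_le_card_sdiff_add (A := U) (B := I) hwP
    exact le_min (by omega) (hrep w)
  -- the pair count is `Σ_{w ∈ S0} r_{U,I}(w)`
  have hpairs : ((U ×ˢ I).filter (fun p => p.1 + p.2 ∉ P)).card = ∑ w ∈ S0, rep U I w := by
    rw [card_eq_sum_card_fiberwise (f := fun p : G × G => p.1 + p.2) (t := S0)
      (s := (U ×ˢ I).filter (fun p => p.1 + p.2 ∉ P))]
    · refine sum_congr rfl fun w hw => ?_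
      rw [rep_def]
      congr 1
      ext p
      simp only [mem_filter, mem_product]
      constructor
      · rintro ⟨⟨hp, _⟩, he⟩; exact ⟨hp, he⟩
      · rintro ⟨hp, he⟩; exact ⟨⟨hp, by rw [he]; exact (mem_filter.1 hw).2⟩, he⟩
    · intro p hp
      have h := mem_filter.1 (mem_coe.1 hp)
      exact mem_coe.2 (mem_filter.2 ⟨hsub (add_mem_add (mem_product.1 h.1).1 (mem_product.1 h.1).2), h.2⟩)
  have h4 := sum_filter_add_sum_filter_not S0 (fun w => w ∈ E) (fun w => rep U I w)
  have h5 : ∑ w ∈ S0.filter (fun w => w ∈ E), rep U I w ≤ l * E.card := by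
    have hsubE : S0.filter (fun w => w ∈ E) ⊆ E := fun w hw => (mem_filter.1 hw).2
    calc ∑ w ∈ S0.filter (fun w => w ∈ E), rep U I w ≤ ∑ w ∈ S0.filter (fun w => w ∈ E), l :=
          sum_le_sum fun w hw => rep_le_card_sdiff_add (mem_filter.1 (mem_filter.1 hw).1).2
      _ = (S0.filter (fun w => w ∈ E)).card * l := by rw [sum_const, smul_eq_mul]
      _ ≤ E.card * l := Nat.mul_le_mul_right l (card_le_card hsubE)
      _ = l * E.card := mul_comm _ _
  rw [hpairs, hN]
  omega

/-- Two distinct cosets of `H = stab(S)` through points of `U` carry at least `2|H| − ρ_U` points of `U`: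
`2|H| ≤ |U ∩ (a + H)| + |U ∩ (b + H)| + (|U + H| − |U|)`. [cite: Grynkiewicz2010, §2 Case 4.2] -/
theorem two_cosets_holes {S U : Finset G} (hS : S.Nonempty) {a b : G} (ha : a ∈ U) (hb : b ∈ U)
    (hab : Disjoint (a +ᵥ S.addStab) (b +ᵥ S.addStab)) :
    2 * S.addStab.card ≤ (U ∩ (a +ᵥ S.addStab)).card + (U ∩ (b +ᵥ S.addStab)).card +
      ((U + S.addStab).card - U.card) := by
  set H := S.addStab with hH
  have hQa : a +ᵥ H ⊆ U + H := coset_subset_add ha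
  have hQb : b +ᵥ H ⊆ U + H := coset_subset_add hb
  have hU : U ⊆ U + H := subset_add_addStab hS U
  -- `|U + H| ≥ |Q_a ∪ Q_b ∪ U|`
  have h1 : ((a +ᵥ H) ∪ (b +ᵥ H) ∪ U).card ≤ (U + H).card :=
    card_le_card (union_subset (union_subset hQa hQb) hU)
  have h2 : ((a +ᵥ H) ∪ (b +ᵥ H) ∪ U).card + (((a +ᵥ H) ∪ (b +ᵥ H)) ∩ U).card =
      ((a +ᵥ H) ∪ (b +ᵥ H)).card + U.card := card_union_add_card_inter _ _
  have h3 : ((a +ᵥ H) ∪ (b +ᵥ H)).card = H.card + H.card := by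
    rw [card_union_of_disjoint hab, card_coset, card_coset]
  have h4 : (((a +ᵥ H) ∪ (b +ᵥ H)) ∩ U).card ≤ (U ∩ (a +ᵥ H)).card + (U ∩ (b +ᵥ H)).card := by
    rw [union_inter_distrib_right, inter_comm (a +ᵥ H), inter_comm (b +ᵥ H)]
    exact card_union_le _ _
  have h5 := card_le_card hU
  omega

/-- For `x ∈ X`, `y ∈ Y` and `H = stab(X + Y)`: `|H| ≤ r_{X,Y}(x + y) + ρ` where
`ρ = |X + H| − |X| + |Y + H| − |Y|`. [cite: Grynkiewicz2010, §2 Step 1] -/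
theorem le_rep_add_holes {X Y : Finset G} {x y : G} (hx : x ∈ X) (hy : y ∈ Y) :
    (X + Y).addStab.card ≤ rep X Y (x + y) +
      (((X + (X + Y).addStab).card - X.card) + ((Y + (X + Y).addStab).card - Y.card)) := by
  have hS : (X + Y).Nonempty := ⟨x + y, add_mem_add hx hy⟩
  have h1 := card_addStab_le_card_inter_coset_add_holes hS hx (A := X) (S := X + Y)
  have h2 := card_addStab_le_card_inter_coset_add_holes hS hy (A := Y) (S := X + Y)
  have h3 := card_inter_coset_add_le_rep_add X Y x y (S := X + Y)
  omega

/-- **Adding a popular element on the right** (the device of [Gry10] §2 Case 4.2).  Let `t ≥ 2`, `t² ≤ c`,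
`|A|, |B| ≥ t`, the induction hypothesis hold below `(A,B)`, and let `α ∉ B` be such that every `a + α`
(`a ∈ A`) already has `≥ t` representations in `A + B`.  Then `Goal t c A B` (apply the hypothesis to
`(A, B ∪ {α})`, which has the same `N_t` and the same `t`-popular sums, and remove `α` again).
[cite: Grynkiewicz2010, §2 Case 4.2] -/
theorem goal_of_insert_right (ht : 2 ≤ t) (hc : t * t ≤ c) (ih : IH t c A B) (hA : t ≤ A.card)
    (hB : t ≤ B.card) {α : G} (hα : α ∉ B) (hpop : ∀ a ∈ A, t ≤ rep A B (a + α)) : Goal t c A B := by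
  set Y := insert α B with hY
  have hNS : NS t A Y = NS t A B := NS_insert_right_of_popular t A hα hpop
  have hYc : Y.card = B.card + 1 := card_insert_of_notMem hα
  have hle : ∀ w, t ≤ rep A Y w ↔ t ≤ rep A B w := le_rep_insert_right_iff t A hα hpop
  have h2N := card_add_card_lt_two_mul_NS ht hA hB
  have hmeas : meas t A Y < meas t A B :=
    meas_lt_of_card_lt hNS (by rw [hYc]; omega) (by rw [hYc]; omega)
  rcases ih A Y hmeas hA (by rw [hYc]; omega) with hP | ⟨X', Y', hS⟩
  · left; rw [hNS, hYc] at hP; linarith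
  obtain ⟨hX'ne, hY'ne⟩ := hS.nonempty hA (by rw [hYc]; omega)
  obtain ⟨X'', Y'', hS2, hsum, hsubX, hsubY, hsX, hsY⟩ := hS.saturate hX'ne hY'ne
  rw [← hsum] at hsX hsY
  have hX''ne : X''.Nonempty := hX'ne.mono hsubX
  have hY''ne : Y''.Nonempty := hY'ne.mono hsubY
  rcases step_one hS2 hX''ne hY''ne hsX hsY with h1 | ⟨-, hHρ, -⟩
  · left; rw [hNS, hYc] at h1; linarith
  obtain ⟨hX''A, hY''Y, hl, hpopS, hin⟩ := hS2
  set H := (X'' + Y'').addStab with hH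
  -- every element of `X'' + Y''` has at least `|H| − ρ − 1 ≥ t` representations avoiding `α`
  have hbig : ∀ w ∈ X'' + Y'', t ≤ rep X'' (Y''.erase α) w := by
    intro w hw
    obtain ⟨x, hx, y, hy, rfl⟩ := mem_add.1 hw
    have h1 := le_rep_add_holes hx hy
    rw [← hH] at h1
    by_cases hαY : α ∈ Y''
    · have h2 := rep_erase_right (A := X'') hαY (x + y)
      have h3 : rep X'' Y'' (x + y) ≤ rep X'' (Y''.erase α) (x + y) + 1 := by
        rw [h2]; split_ifs <;> omega
      omega
    · rw [erase_eq_of_notMem hαY]; omega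
  have hY3B : Y''.erase α ⊆ B := fun y hy => by
    have hy' := mem_erase.1 hy
    have := hY''Y hy'.2
    rw [hY, mem_insert] at this
    exact this.resolve_left hy'.1
  right
  refine ⟨X'', Y''.erase α, hX''A, hY3B, ?_, fun w hw => ?_, fun w hw => ?_⟩
  · -- deletions
    have e1 : B \ Y''.erase α = B \ Y'' := by
      ext b
      simp only [mem_sdiff, mem_erase, not_and]
      constructor
      · rintro ⟨hb, h⟩
        exact ⟨hb, fun hbY => by have := h (fun e => hα (e ▸ hb)); exact absurd hbY this⟩
      · rintro ⟨hb, h⟩; exact ⟨hb, fun _ => h⟩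
    have e2 : (B \ Y'').card ≤ (Y \ Y'').card :=
      card_le_card (sdiff_subset_sdiff (subset_insert α B) (Subset.refl _))
    rw [e1]; omega
  · -- popularity inside `X'' + (Y'' \ {α})`
    exact hbig w (add_subset_add_left (erase_subset α Y'') hw)
  · -- every `t`-popular sum of `A + B` lies in `X'' + (Y'' \ {α})`
    have hwY : t ≤ rep A Y w := (hle w).2 hw
    have hw' := hin w hwY
    exact mem_add_of_le_rep (by omega) (hbig w hw')

/-- **Adding a popular element on the left.** [cite: Grynkiewicz2010, §2 Case 4.2] -/
theorem goal_of_insert_left (ht : 2 ≤ t) (hc : t * t ≤ c) (ih : IH t c A B) (hA : t ≤ A.card)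
    (hB : t ≤ B.card) {α : G} (hα : α ∉ A) (hpop : ∀ b ∈ B, t ≤ rep A B (α + b)) : Goal t c A B := by
  refine (goal_of_insert_right ht hc ih.symm hB hA hα fun b hb => ?_).symm
  rw [rep_comm, add_comm]; exact hpop b hb

/-- From a set `F` of partners whose sums with `a` avoid `P`, at most `t − 1` of which are unpopular,
extract the popular sums: `E = {a + i : i ∈ F, r(a + i) > t}` has `|E| + (t − 1) ≥ |F|`.
[cite: Grynkiewicz2010, §2 Case 4.1] -/
theorem popular_part {F P : Finset G} {a : G} (hF : ∀ i ∈ F, a + i ∉ P)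
    (hfew : (F.filter (fun i => rep A B (a + i) ≤ t)).card + 1 ≤ t) :
    F.card ≤ ((F.filter (fun i => t < rep A B (a + i))).image (a + ·)).card + (t - 1) ∧
    Disjoint ((F.filter (fun i => t < rep A B (a + i))).image (a + ·)) P ∧
    ∀ w ∈ (F.filter (fun i => t < rep A B (a + i))).image (a + ·), t ≤ rep A B w := by
  refine ⟨?_, ?_, ?_⟩
  · rw [card_image_of_injective _ (add_right_injective a)]
    have := card_filter_add_card_filter_not (s := F) (fun i => rep A B (a + i) ≤ t)
    have e : F.filter (fun i => ¬ rep A B (a + i) ≤ t) = F.filter (fun i => t < rep A B (a + i)) :=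
      filter_congr fun i _ => not_le
    rw [e] at this
    omega
  · rw [disjoint_left]
    intro w hw hwP
    obtain ⟨i, hi, rfl⟩ := mem_image.1 hw
    exact hF i (mem_filter.1 hi).1 hwP
  · intro w hw
    obtain ⟨i, hi, rfl⟩ := mem_image.1 hw
    exact (mem_filter.1 hi).2.le

end Tools

/-! ### Case 4.1 -/

section Case41

variable {t c : ℕ} {A B : Finset G}

/-- The arithmetic of Case 4.1 (i): with `d = |H| − ρ ≥ 2t − 1`, `|E| + t ≥ d + 1`, `l + 1 ≤ t`,
the key count contradicts `N_t + t² < t(|A| + |B|)`. [cite: Grynkiewicz2010, §2 Case 4.1] -/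
theorem case41i_arith {t l d e S N P ab : ℕ} (hlt : l + 1 ≤ t) (hd : 2 * t ≤ d + 1) (he : d ≤ e + (t - 1))
    (hS : S + d + l = ab) (hP : l * d ≤ P) (hK : t * S + t * e + P ≤ N + l * e)
    (hW : N + t * t < t * ab) : False := by
  obtain ⟨q, rfl⟩ : ∃ q, t = l + q + 1 := ⟨t - l - 1, by omega⟩
  have ht1 : l + q + 1 - 1 = l + q := by omega
  rw [ht1] at he
  obtain ⟨r, hr⟩ : ∃ r, e + (l + q) = d + r := ⟨e + (l + q) - d, by omega⟩
  have h1 : (q + 1) * (e + (l + q)) = (q + 1) * (d + r) := by rw [hr]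
  subst hS
  nlinarith [h1, hP, hK, hW]

/-- The arithmetic of Case 4.1 (ii): with `d = |H| − ρ ≥ 2t − 1`, `|E| + 2t ≥ d + 2`, `1 ≤ l ≤ t − 1`, the
key count gives `N_t + 2t² ≥ t(|A| + |B|) + 2t`. [cite: Grynkiewicz2010, §2 Case 4.1] -/
theorem case41ii_arith {t l d e S N P ab : ℕ} (hlt : l + 1 ≤ t) (hl1 : 1 ≤ l) (hd : 2 * t ≤ d + 1)
    (he : d ≤ e + (2 * t - 2)) (hS : S + d + l = ab) (hP : l * d ≤ P) (hK : t * S + t * e + P ≤ N + l * e) :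
    t * ab + 2 * t ≤ N + 2 * t * t := by
  obtain ⟨q, rfl⟩ : ∃ q, t = l + q + 1 := ⟨t - l - 1, by omega⟩
  have ht1 : 2 * (l + q + 1) - 2 = 2 * l + 2 * q := by omega
  rw [ht1] at he
  obtain ⟨r, hr⟩ : ∃ r, e + (2 * l + 2 * q) = d + r := ⟨e + (2 * l + 2 * q) - d, by omega⟩
  have h1 : (q + 1) * (e + (2 * l + 2 * q)) = (q + 1) * (d + r) := by rw [hr]
  have h2 : l ≤ l * (l + q) := Nat.le_mul_of_pos_right l (by omega)
  subst hS
  nlinarith [h1, hP, hK, h2]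

/-- **[Gry10] §2 Case 4.1.**  In the STEP 4 situation — `(U,I) = (A ∪ B, A ∩ B)` carries a saturated
Kneser-tight structure `(U′, I′)` with `|H| ≥ ρ + 2t − 1`, and the Pollard bound fails for `(A,B)`
(`N_t + t² < t(|A| + |B|)`, `2t² ≤ c + 2t`) — if `l ≥ 1` then `Goal t c A B`.
[cite: Grynkiewicz2010, §2 Case 4.1] -/
theorem case41 (ht : 2 ≤ t) (hc : t * t ≤ c) (hc3 : 2 * t * t ≤ c + 2 * t) (ih : IH t c A B)
    (hA : t + 1 ≤ A.card) (hB : t + 1 ≤ B.card) {U' I' : Finset G}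
    (hS : Str t (A ∪ B) (A ∩ B) U' I') (hU'ne : U'.Nonempty) (hI'ne : I'.Nonempty)
    (hsU : Sat (A ∪ B) U' (U' + I').addStab) (hsI : Sat (A ∩ B) I' (U' + I').addStab)
    (htight : (U' + I').card + (U' + I').addStab.card =
      (U' + (U' + I').addStab).card + (I' + (U' + I').addStab).card)
    (hHρ : ((U' + (U' + I').addStab).card - U'.card) + ((I' + (U' + I').addStab).card - I'.card) + 2 * t ≤
      (U' + I').addStab.card + 1)
    (hP : NS t A B + c < t * (A.card + B.card))
    (hl : 1 ≤ ((A ∪ B) \ U').card + ((A ∩ B) \ I').card) : Goal t c A B := by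
  have hW : NS t A B + t * t < t * (A.card + B.card) := by omega
  set U := A ∪ B with hU
  set I := A ∩ B with hI
  set H := (U' + I').addStab with hH
  set l := (U \ U').card + (I \ I').card with hl'
  set ρ := ((U' + H).card - U'.card) + ((I' + H).card - I'.card) with hρ
  have hSne : (U' + I').Nonempty := hU'ne.add hI'ne
  have hper : U' + I' + H = U' + I' := add_addStab _
  have hrep : ∀ w, rep U I w ≤ rep A B w := rep_union_inter_le A B
  have hsubUI : U + I ⊆ A + B := union_add_inter_subset A B
  have hlt : l + 1 ≤ t := hS.2.2.1
  have hρU : U'.card ≤ (U' + H).card := card_le_card_add_addStab hSne U'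
  have hρI : I'.card ≤ (I' + H).card := card_le_card_add_addStab hSne I'
  obtain ⟨d, hd⟩ : ∃ d, H.card = ρ + d := ⟨H.card - ρ, by omega⟩
  have hpairs := pairs_outside_ge hS.1 hS.2.1 hU'ne hI'ne htight hsU hsI
  rw [← hH, ← hl', hd, Nat.add_sub_cancel_left] at hpairs
  have hcU := card_sdiff_add_card_eq_card hS.1
  have hcI := card_sdiff_add_card_eq_card hS.2.1
  have hcardUI : U.card + I.card = A.card + B.card := card_union_add_card_inter A B
  have hSd : (U' + I').card + d + l = A.card + B.card := by omega
  by_cases hUeq : U' = U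
  · -- (ii) `U' = U`: some `b ∈ I \ I'`
    have hIne : I' ≠ I := by
      intro h; rw [hUeq, h] at hl'; simp at hl'; omega
    obtain ⟨b, hbI, hbI'⟩ := exists_of_ssubset (hS.2.1.ssubset_of_ne hIne)
    have hbA : b ∈ A := (mem_inter.1 hbI).1
    have hbB : b ∈ B := (mem_inter.1 hbI).2
    have hbH : b ∉ I' + H := fun h => hbI' (hsI b hbI h)
    have hF := card_filter_add_not_mem_ge_right hU'ne hI'ne htight hbH
    rw [← hH] at hF
    set F := U'.filter (fun u => u + b ∉ U' + I') with hFdef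
    -- unpopular row / column of `b`
    by_cases hrow : t ≤ (A.filter (fun a => rep A B (a + b) ≤ t)).card
    · exact goal_of_row (by omega) hc ih hA hB hbB hrow
    by_cases hcol : t ≤ (B.filter (fun β => rep A B (b + β) ≤ t)).card
    · exact goal_of_col (by omega) hc ih hA hB hbA hcol
    rw [not_le] at hrow hcol
    exfalso
    -- the unpopular partners of `b` inside `F` number at most `2t − 2`
    have hfew : (F.filter (fun u => rep A B (b + u) ≤ t)).card + 1 ≤ 2 * t - 1 := by
      have hsplit : F.filter (fun u => rep A B (b + u) ≤ t) ⊆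
          A.filter (fun a => rep A B (a + b) ≤ t) ∪ B.filter (fun β => rep A B (b + β) ≤ t) := by
        intro u hu
        rw [mem_filter] at hu
        have huU : u ∈ U := hS.1 (mem_filter.1 hu.1).1
        rw [mem_union, mem_filter, mem_filter]
        rcases mem_union.1 huU with huA | huB
        · left; exact ⟨huA, by rw [add_comm]; exact hu.2⟩
        · right; exact ⟨huB, hu.2⟩
      have := (card_le_card hsplit).trans (card_union_le _ _)
      omega
    have hFout : ∀ u ∈ F, b + u ∉ U' + I' := fun u hu => by
      rw [add_comm b u]; exact (mem_filter.1 hu).2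
    -- the popular sums `b + u`, `u ∈ F`, `r > t` (we use threshold `t` via `popular_part` at `2t - 1`? no:)
    have hfew' : (F.filter (fun u => rep A B (b + u) ≤ t)).card + 1 ≤ t + (t - 1) := by omega
    -- extract the `t`-popular part by hand (threshold `t`, at most `2t - 2` exceptions)
    set E := (F.filter (fun u => t < rep A B (b + u))).image (b + ·) with hEdef
    have hE1 : F.card ≤ E.card + (2 * t - 2) := by
      rw [hEdef, card_image_of_injective _ (add_right_injective b)]
      have := card_filter_add_card_filter_not (s := F) (fun u => rep A B (b + u) ≤ t)
      have e : F.filter (fun u => ¬ rep A B (b + u) ≤ t) = F.filter (fun u => t < rep A B (b + u)) :=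
        filter_congr fun u _ => not_le
      rw [e] at this
      omega
    have hE2 : Disjoint E (U' + I') := by
      rw [disjoint_left]
      intro w hw hwP
      obtain ⟨u, hu, rfl⟩ := mem_image.1 hw
      exact hFout u (mem_filter.1 hu).1 hwP
    have hE3 : ∀ w ∈ E, t ≤ rep A B w := by
      intro w hw
      obtain ⟨u, hu, rfl⟩ := mem_image.1 hw
      exact (mem_filter.1 hu).2.le
    have hEsub : E ⊆ A + B := by
      intro w hw
      obtain ⟨u, hu, rfl⟩ := mem_image.1 hw
      have huU : u ∈ U := hS.1 (mem_filter.1 (mem_filter.1 hu).1).1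
      rcases mem_union.1 huU with huA | huB
      · rw [add_comm b u]; exact add_mem_add huA hbB
      · exact add_mem_add hbA huB
    have hK := key_count hS hrep hsubUI hEsub hE2 hE3
    rw [← hl'] at hK
    have he : d ≤ E.card + (2 * t - 2) := by omega
    have := case41ii_arith hlt hl (by omega) he hSd hpairs hK
    omega
  · -- (i) some `a ∈ U \ U'`
    obtain ⟨a, haU, haU'⟩ := exists_of_ssubset (hS.1.ssubset_of_ne hUeq)
    have haH : a ∉ U' + H := fun h => haU' (hsU a haU h)
    have hF := card_filter_add_not_mem_ge_left hU'ne hI'ne htight haH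
    rw [← hH] at hF
    set F := I'.filter (fun i => a + i ∉ U' + I') with hFdef
    have hFout : ∀ i ∈ F, a + i ∉ U' + I' := fun i hi => (mem_filter.1 hi).2
    have hFI : ∀ i ∈ F, i ∈ I := fun i hi => hS.2.1 (mem_filter.1 hi).1
    rcases mem_union.1 haU with haA | haB
    · -- `a ∈ A`: its column
      by_cases hcol : t ≤ (B.filter (fun β => rep A B (a + β) ≤ t)).card
      · exact goal_of_col (by omega) hc ih hA hB haA hcol
      rw [not_le] at hcol
      exfalso
      have hfew : (F.filter (fun i => rep A B (a + i) ≤ t)).card + 1 ≤ t := by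
        have hsplit : F.filter (fun i => rep A B (a + i) ≤ t) ⊆ B.filter (fun β => rep A B (a + β) ≤ t) := by
          intro i hi
          rw [mem_filter] at hi ⊢
          exact ⟨(mem_inter.1 (hFI i hi.1)).2, hi.2⟩
        have := card_le_card hsplit
        omega
      obtain ⟨hE1, hE2, hE3⟩ := popular_part (A := A) (B := B) (t := t) hFout hfew
      set E := (F.filter (fun i => t < rep A B (a + i))).image (a + ·) with hEdef
      have hEsub : E ⊆ A + B := by
        intro w hw
        obtain ⟨i, hi, rfl⟩ := mem_image.1 hw
        exact add_mem_add haA (mem_inter.1 (hFI i (mem_filter.1 hi).1)).2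
      have hK := key_count hS hrep hsubUI hEsub hE2 hE3
      rw [← hl'] at hK
      exact case41i_arith hlt (by omega) (by omega) hSd hpairs hK hW
    · -- `a ∈ B`: its row
      by_cases hrow : t ≤ (A.filter (fun α => rep A B (α + a) ≤ t)).card
      · exact goal_of_row (by omega) hc ih hA hB haB hrow
      rw [not_le] at hrow
      exfalso
      have hfew : (F.filter (fun i => rep A B (a + i) ≤ t)).card + 1 ≤ t := by
        have hsplit : F.filter (fun i => rep A B (a + i) ≤ t) ⊆ A.filter (fun α => rep A B (α + a) ≤ t) := by
          intro i hi
          rw [mem_filter] at hi ⊢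
          exact ⟨(mem_inter.1 (hFI i hi.1)).1, by rw [add_comm]; exact hi.2⟩
        have := card_le_card hsplit
        omega
      obtain ⟨hE1, hE2, hE3⟩ := popular_part (A := A) (B := B) (t := t) hFout hfew
      set E := (F.filter (fun i => t < rep A B (a + i))).image (a + ·) with hEdef
      have hEsub : E ⊆ A + B := by
        intro w hw
        obtain ⟨i, hi, rfl⟩ := mem_image.1 hw
        rw [add_comm a i]
        exact add_mem_add (mem_inter.1 (hFI i (mem_filter.1 hi).1)).1 haB
      have hK := key_count hS hrep hsubUI hEsub hE2 hE3
      rw [← hl'] at hK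
      exact case41i_arith hlt (by omega) (by omega) hSd hpairs hK hW

end Case41

end Grynkiewicz

end Literature.Combinatorics.Additive
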